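import Literature.AnabelianGeometry.EtaleTheta.DivisorMonoidsOfGaloisCoveringCoset
import Literature.AnabelianGeometry.EtaleTheta.BiKummerThm44SubModelConnectedBinjRootsReading
import Literature.AnabelianGeometry.EtaleTheta.BiKummerThm44SubModelConnectedBinjWeak
import Literature.AnabelianGeometry.EtaleTheta.Discharge.Sec3BLambdaInjectiveOfRlf
import Literature.AnabelianGeometry.EtaleTheta.Discharge.Sec3BLambdaInjectiveOfRlfRReflects

/-!
# [EtTh] Theorem 4.4 (i)(ii)(iii) + `N`-th roots at the genuine connected base over the constructed Def 3.3 (iii) data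
# on the SMALL coset model of `D₀`: `hBinj` a theorem at all six Def 3.6 (i) constructors, base field in ANY universe
# (proof-only; the FULL forms with the Kummer-class clause are in the sequel `…CosetFull.lean`)

S. Mochizuki, *The étale theta function and its Frobenioid-theoretic manifestations*, Publ. RIMS **45** (2009)
[MochizukiEtTh2009], §4, Thm 4.4 (i)–(iii), PDF p.94 (printed p.320), proof PDF p.95; §3, Def 3.3 (iii) PDF p.73, Prop 3.4
(i) PDF p.74, Def 3.6 (i)(ii) PDF pp.76–77; [MochizukiFrdII2008] Def 2.1 (ii) p.17 (Kummer class).  abc-iut cell, layer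
L2, plan/L2/SUBDAG-EtTh-Thm44.md (custodian lineage abc-iut-w5-d179), cone nodes `EtTh:Thm4.4(i)`, `EtTh:Thm4.4(ii)`,
`EtTh:Thm4.4(iii)` (+ sub-DAG row T44-L16).  Seat abc-iut-w5-d179 (gen 5).  PROOF-ONLY (0 `def`s, no `Prop` facts, no
instances); nothing landed is edited or restated.

WHY.  `BiKummerThm44SubModelConnectedOfGaloisCovering.lean` (p439044) knits the lineage's Thm 4.4 closers onto
abc-iut-w6-d058's connected model `ofGaloisActionConnected` — whose base lives one universe above `G`, forcing
`K : Type (u+1)` and excluding abc-iut-L2-t3's FULL form with the Kummer-class clause (`Sec4Thm44KummerClassConnected.lean`,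
p439173 / p439960: `K, Π^tp_X, D₀ : Type 0`).  Over the coset model `DivisorMonoids.ofGaloisActionCoset A hZ`
(`DivisorMonoidsOfGaloisCoveringCoset.lean`: objects `Subgroup G : Type u`) the base field may live in ANY universe `u`,
in particular `u = 0`:

* §0 `hBinj` THEOREMS at `ofRlfZ[Weak]` / `ofRlfQ[Weak]` / `ofRlfR[Weak]` of the coset data (abc-iut-L2-t3's
  `ofRlf{Z,Q}[Weak]_hBinj`, abc-iut-w6-d048's `ofRlfR[Weak]_hBinj_of_reflects`, with `hB₀inj` / `hΦinj` / `hΦrefl` the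
  coset-model theorems);
* §1 weak `Λ = ℤ`, `K : Type u`: «`C` Frobenioid», T44-L03, Thm 4.4 (i) UNCONDITIONAL; **Thm 4.4 (i) ∧ (ii) ∧ (iii) ∧
  roots ⇐ {T44-L15b} ONLY; at the ROOTS READING ⇐ NOTHING**;
* §2 strong `Λ = ℤ` twins (`ofRlfZ … hpf`, printed perf-factorial slot as constructor parameter);
* the FULL forms with the Kummer-class clause (universe `0`) are in the sequel
  `BiKummerThm44SubModelConnectedOfGaloisCoveringCosetFull.lean`.

HONEST FRAMING: refereed pre-IUT material; every theorem is an implication for data so parametrised (`LogDivisorModel` /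
`GaloisAction` / `CuspLaws` are interface and parameter records — nothing asserts they arise from an actual curve; NV of the
quantified class of tempered Frobenioids over constructed data is abc-iut-w6-d048's finding F-w6d048g3-1 / row in
flight); one term of the Def 3.3 (iii) limit (Rmk 3.3.1); the roots reading is WEAKER than print's cohomological [FrdII] Def 2.2
(ii)(c); weak vocabulary = the reading of record (plan/FACT-LIST F-L2d2-1); nothing here bears on the disputed [IUTchIII]
Cor. 3.12; typed ≠ proved — here PROVED (kernel compositions).
-/

noncomputable section

namespace Literature.AnabelianGeometry.EtaleTheta

open CategoryTheory Opposite Function Literature.AlgebraicGeometry.Frobenioids Literature.AnabelianGeometry.SemiGraphs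

universe u v₀

/-! ### §0 `hBinj` at the six Def 3.6 (i) constructors over the coset data: THEOREMS -/

namespace DivisorMonoids

open LogDivisorModel.GaloisAction

variable {Z : LogDivisorModel.{u}} {G : Type u} [Group G] (A : Z.GaloisAction G) (hZ : Z.CuspLaws)

/-- `hBinj` at the weak `Λ = ℤ` data over the coset model (any `hpf`). [cite: MochizukiEtTh2009, Def 3.6 p.76] -/
theorem ofGaloisActionCoset_ofRlfZWeak_hBinj
    (hpf : ∀ Y : (InducedCategory (Action (Type u) G) (cosetGSet G))ᵒᵖ, IsPerfFactorialCof ((ofGaloisActionCoset A hZ).Φ₀.obj Y)) :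
    ∀ {Y Y' : (InducedCategory (Action (Type u) G) (cosetGSet G))ᵒᵖ} (g : Y ⟶ Y'),
      Injective ((RealifiedDivisorMonoids.ofRlfZWeak (ofGaloisActionCoset A hZ) hpf).BΛ.map g).hom :=
  RealifiedDivisorMonoids.ofRlfZWeak_hBinj (ofGaloisActionCoset A hZ) hpf
    fun g => ofGaloisActionCoset_B₀_map_injective A hZ g

/-- `hBinj` at the weak `Λ = ℚ` data over the coset model (any `hpf`). [cite: MochizukiEtTh2009, Def 3.6 p.76] -/
theorem ofGaloisActionCoset_ofRlfQWeak_hBinj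
    (hpf : ∀ Y : (InducedCategory (Action (Type u) G) (cosetGSet G))ᵒᵖ, IsPerfFactorialCof ((ofGaloisActionCoset A hZ).Φ₀.obj Y)) :
    ∀ {Y Y' : (InducedCategory (Action (Type u) G) (cosetGSet G))ᵒᵖ} (g : Y ⟶ Y'),
      Injective ((RealifiedDivisorMonoids.ofRlfQWeak (ofGaloisActionCoset A hZ) hpf).BΛ.map g).hom :=
  RealifiedDivisorMonoids.ofRlfQWeak_hBinj (ofGaloisActionCoset A hZ) hpf
    fun g => ofGaloisActionCoset_B₀_map_injective A hZ g

/-- `hBinj` at the weak `Λ = ℝ` data over the coset model (any `hpf`; abc-iut-w6-d048's reflects route).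
[cite: MochizukiEtTh2009, Def 3.6 p.76] -/
theorem ofGaloisActionCoset_ofRlfRWeak_hBinj
    (hpf : ∀ Y : (InducedCategory (Action (Type u) G) (cosetGSet G))ᵒᵖ, IsPerfFactorialCof ((ofGaloisActionCoset A hZ).Φ₀.obj Y)) :
    ∀ {Y Y' : (InducedCategory (Action (Type u) G) (cosetGSet G))ᵒᵖ} (g : Y ⟶ Y'),
      Injective ((RealifiedDivisorMonoids.ofRlfRWeak (ofGaloisActionCoset A hZ) hpf).BΛ.map g).hom :=
  RealifiedDivisorMonoids.ofRlfRWeak_hBinj_of_reflects (ofGaloisActionCoset A hZ) hpf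
    (fun g => ofGaloisActionCoset_Φ₀_map_injective A hZ g)
    (fun g a b h => ofGaloisActionCoset_Φ₀_map_reflects_dvd A hZ g a b h)

/-- `hBinj` at the strong `Λ = ℤ` data over the coset model (printed perf-factorial slot `hpf` as parameter).
[cite: MochizukiEtTh2009, Def 3.6 p.76] -/
theorem ofGaloisActionCoset_ofRlfZ_hBinj
    (hpf : ∀ Y : (InducedCategory (Action (Type u) G) (cosetGSet G))ᵒᵖ, IsPerfFactorial ((ofGaloisActionCoset A hZ).Φ₀.obj Y)) :
    ∀ {Y Y' : (InducedCategory (Action (Type u) G) (cosetGSet G))ᵒᵖ} (g : Y ⟶ Y'),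
      Injective ((RealifiedDivisorMonoids.ofRlfZ (ofGaloisActionCoset A hZ) hpf).BΛ.map g).hom :=
  RealifiedDivisorMonoids.ofRlfZ_hBinj (ofGaloisActionCoset A hZ) hpf fun g => ofGaloisActionCoset_B₀_map_injective A hZ g

/-- `hBinj` at the strong `Λ = ℚ` data over the coset model. [cite: MochizukiEtTh2009, Def 3.6 p.76] -/
theorem ofGaloisActionCoset_ofRlfQ_hBinj
    (hpf : ∀ Y : (InducedCategory (Action (Type u) G) (cosetGSet G))ᵒᵖ, IsPerfFactorial ((ofGaloisActionCoset A hZ).Φ₀.obj Y)) :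
    ∀ {Y Y' : (InducedCategory (Action (Type u) G) (cosetGSet G))ᵒᵖ} (g : Y ⟶ Y'),
      Injective ((RealifiedDivisorMonoids.ofRlfQ (ofGaloisActionCoset A hZ) hpf).BΛ.map g).hom :=
  RealifiedDivisorMonoids.ofRlfQ_hBinj (ofGaloisActionCoset A hZ) hpf fun g => ofGaloisActionCoset_B₀_map_injective A hZ g

/-- `hBinj` at the strong `Λ = ℝ` data over the coset model (abc-iut-w6-d048's reflects route).
[cite: MochizukiEtTh2009, Def 3.6 p.76] -/
theorem ofGaloisActionCoset_ofRlfR_hBinj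
    (hpf : ∀ Y : (InducedCategory (Action (Type u) G) (cosetGSet G))ᵒᵖ, IsPerfFactorial ((ofGaloisActionCoset A hZ).Φ₀.obj Y)) :
    ∀ {Y Y' : (InducedCategory (Action (Type u) G) (cosetGSet G))ᵒᵖ} (g : Y ⟶ Y'),
      Injective ((RealifiedDivisorMonoids.ofRlfR (ofGaloisActionCoset A hZ) hpf).BΛ.map g).hom :=
  RealifiedDivisorMonoids.ofRlfR_hBinj_of_reflects (ofGaloisActionCoset A hZ) hpf
    (fun g => ofGaloisActionCoset_Φ₀_map_injective A hZ g)
    (fun g a b h => ofGaloisActionCoset_Φ₀_map_reflects_dvd A hZ g a b h)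

end DivisorMonoids

namespace BiKummerSetting

open LogDivisorModel.GaloisAction

/-! ### §1 Weak `Λ = ℤ` coset data, base field `K : Type u` -/

section Weak

variable {Z₁ : LogDivisorModel.{u}} {G₁ : Type u} [Group G₁] (GA₁ : Z₁.GaloisAction G₁) (hC₁ : Z₁.CuspLaws)
  {Z₂ : LogDivisorModel.{u}} {G₂ : Type u} [Group G₂] (GA₂ : Z₂.GaloisAction G₂) (hC₂ : Z₂.CuspLaws)
  {K : Type u} [Field K] {K' : Type u} [Field K'] {X₁ : SemiGraphs.TemperedArithmeticGroup.{u} K}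
  {X₂ : SemiGraphs.TemperedArithmeticGroup.{u} K'}
  {IsRational₁ IsStrictlyRational₁ : ((ConnectedPart (BTemp X₁.Pi))ᵒᵖ ⥤ CommMonCat.{u}) → Prop}
  {IsRational₂ IsStrictlyRational₂ : ((ConnectedPart (BTemp X₂.Pi))ᵒᵖ ⥤ CommMonCat.{u}) → Prop}

/-- **«`C` is a Frobenioid» for ANY tempered Frobenioid over the weak coset data — unconditional.**
[cite: MochizukiEtTh2009, Def 3.6 p.77] -/
theorem isFrobenioid_ofGaloisActionCoset_treeVocabWeak
    {tf₁ : TemperedFrobenioid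
      (RealifiedDivisorMonoids.ofRlfZWeak (DivisorMonoids.ofGaloisActionCoset GA₁ hC₁)
        (DivisorMonoids.ofGaloisActionCoset_isPerfFactorialCof GA₁ hC₁))
      (ConnectedPart (BTemp X₁.Pi)) (treeCatVocab (ConnectedPart (BTemp X₁.Pi)) IsRational₁ IsStrictlyRational₁)}
    : PreFrobenioid.IsFrobenioid tf₁.toElem :=
  tf₁.isFrobenioid_of_structural (DivisorMonoids.ofGaloisActionCoset_ofRlfZWeak_hBinj GA₁ hC₁ _) fun α hα =>
    (QuasiTemperoid.BTempConnected.connectedPart_isOfFSMType (G := X₁.Pi)).isIso_of_isFSM α hα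

/-- **T44-L03 at the genuine connected base over the weak coset data — unconditional.** [cite: MochizukiEtTh2009, Thm 4.4 p.95] -/
theorem Thm44Hyp.preservesFrobeniusStructure_mkOfConnectedTemperoid_ofGaloisActionCoset_treeVocabWeak
    {tf₁ : TemperedFrobenioid
      (RealifiedDivisorMonoids.ofRlfZWeak (DivisorMonoids.ofGaloisActionCoset GA₁ hC₁)
        (DivisorMonoids.ofGaloisActionCoset_isPerfFactorialCof GA₁ hC₁))
      (ConnectedPart (BTemp X₁.Pi)) (treeCatVocab (ConnectedPart (BTemp X₁.Pi)) IsRational₁ IsStrictlyRational₁)}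
    {hZ₁ : tf₁.monoidType = MonoidType.Z} {hP₁ : ∀ A : (ConnectedPart (BTemp X₁.Pi))ᵒᵖ, IsPerfect (tf₁.Φ.carrier A)}
    {NH₁ : Subgroup (Field.absoluteGaloisGroup K) → tf₁.category → ℕ+ → Prop} {A₁ : tf₁.category}
    {hA₁ : PreFrobenioid.IsFrobeniusTrivial tf₁.toElem A₁} {hA₁' : SemiGraphs.IsGaloisObj A₁.base.obj}
    {tf₂ : TemperedFrobenioid
      (RealifiedDivisorMonoids.ofRlfZWeak (DivisorMonoids.ofGaloisActionCoset GA₂ hC₂)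
        (DivisorMonoids.ofGaloisActionCoset_isPerfFactorialCof GA₂ hC₂))
      (ConnectedPart (BTemp X₂.Pi)) (treeCatVocab (ConnectedPart (BTemp X₂.Pi)) IsRational₂ IsStrictlyRational₂)}
    {hZ₂ : tf₂.monoidType = MonoidType.Z} {hP₂ : ∀ B : (ConnectedPart (BTemp X₂.Pi))ᵒᵖ, IsPerfect (tf₂.Φ.carrier B)}
    {NH₂ : Subgroup (Field.absoluteGaloisGroup K') → tf₂.category → ℕ+ → Prop} {A₂ : tf₂.category}
    {hA₂ : PreFrobenioid.IsFrobeniusTrivial tf₂.toElem A₂} {hA₂' : SemiGraphs.IsGaloisObj A₂.base.obj}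
    (h : Thm44Hyp (mkOfConnectedTemperoid X₁ tf₁ hZ₁ hP₁ NH₁ A₁ hA₁ hA₁')
      (mkOfConnectedTemperoid X₂ tf₂ hZ₂ hP₂ NH₂ A₂ hA₂ hA₂')) :
    Thm44Hyp.PreservesFrobeniusStructure (V := treeMonoidVocabWeak.{u}) h :=
  h.preservesFrobeniusStructure_mkOfConnectedTemperoid_of_hBinj_treeVocabWeak
    (DivisorMonoids.ofGaloisActionCoset_ofRlfZWeak_hBinj GA₁ hC₁ _)
    (DivisorMonoids.ofGaloisActionCoset_ofRlfZWeak_hBinj GA₂ hC₂ _)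

/-- **[EtTh] Thm 4.4 (i) at the genuine connected base over the weak coset data — UNCONDITIONAL**, base field in any
universe. [cite: MochizukiEtTh2009, Thm 4.4 p.94] -/
theorem Thm44Hyp.thm44_i_mkOfConnectedTemperoid_ofGaloisActionCoset_treeVocabWeak
    {tf₁ : TemperedFrobenioid
      (RealifiedDivisorMonoids.ofRlfZWeak (DivisorMonoids.ofGaloisActionCoset GA₁ hC₁)
        (DivisorMonoids.ofGaloisActionCoset_isPerfFactorialCof GA₁ hC₁))
      (ConnectedPart (BTemp X₁.Pi)) (treeCatVocab (ConnectedPart (BTemp X₁.Pi)) IsRational₁ IsStrictlyRational₁)}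
    {hZ₁ : tf₁.monoidType = MonoidType.Z} {hP₁ : ∀ A : (ConnectedPart (BTemp X₁.Pi))ᵒᵖ, IsPerfect (tf₁.Φ.carrier A)}
    {NH₁ : Subgroup (Field.absoluteGaloisGroup K) → tf₁.category → ℕ+ → Prop} {A₁ : tf₁.category}
    {hA₁ : PreFrobenioid.IsFrobeniusTrivial tf₁.toElem A₁} {hA₁' : SemiGraphs.IsGaloisObj A₁.base.obj}
    {tf₂ : TemperedFrobenioid
      (RealifiedDivisorMonoids.ofRlfZWeak (DivisorMonoids.ofGaloisActionCoset GA₂ hC₂)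
        (DivisorMonoids.ofGaloisActionCoset_isPerfFactorialCof GA₂ hC₂))
      (ConnectedPart (BTemp X₂.Pi)) (treeCatVocab (ConnectedPart (BTemp X₂.Pi)) IsRational₂ IsStrictlyRational₂)}
    {hZ₂ : tf₂.monoidType = MonoidType.Z} {hP₂ : ∀ B : (ConnectedPart (BTemp X₂.Pi))ᵒᵖ, IsPerfect (tf₂.Φ.carrier B)}
    {NH₂ : Subgroup (Field.absoluteGaloisGroup K') → tf₂.category → ℕ+ → Prop} {A₂ : tf₂.category}
    {hA₂ : PreFrobenioid.IsFrobeniusTrivial tf₂.toElem A₂} {hA₂' : SemiGraphs.IsGaloisObj A₂.base.obj}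
    (h : Thm44Hyp (mkOfConnectedTemperoid X₁ tf₁ hZ₁ hP₁ NH₁ A₁ hA₁ hA₁')
      (mkOfConnectedTemperoid X₂ tf₂ hZ₂ hP₂ NH₂ A₂ hA₂ hA₂')) :
    Thm44_i (V := treeMonoidVocabWeak.{u}) h :=
  h.thm44_i_mkOfConnectedTemperoid_of_hBinj_treeVocabWeak
    (DivisorMonoids.ofGaloisActionCoset_ofRlfZWeak_hBinj GA₁ hC₁ _)
    (DivisorMonoids.ofGaloisActionCoset_ofRlfZWeak_hBinj GA₂ hC₂ _)

/-- **[EtTh] Theorem 4.4 (i) ∧ (ii) ∧ (iii)-saturation ∧ (`N`-th roots) at the genuine connected base `B^temp(Π^tp_X)⁰`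
over the WEAK `Λ = ℤ` data of the coset model ⇐ {T44-L15b} ONLY** (`ψ = psiModel hF₁ hF₂ h3`, any proofs; base field
`K : Type u`). [cite: MochizukiEtTh2009, Thm 4.4 p.94] -/
theorem Thm44Hyp.thm44_mkOfConnectedTemperoid_ofGaloisActionCoset_treeVocabWeak
    {tf₁ : TemperedFrobenioid
      (RealifiedDivisorMonoids.ofRlfZWeak (DivisorMonoids.ofGaloisActionCoset GA₁ hC₁)
        (DivisorMonoids.ofGaloisActionCoset_isPerfFactorialCof GA₁ hC₁))
      (ConnectedPart (BTemp X₁.Pi)) (treeCatVocab (ConnectedPart (BTemp X₁.Pi)) IsRational₁ IsStrictlyRational₁)}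
    {hZ₁ : tf₁.monoidType = MonoidType.Z} {hP₁ : ∀ A : (ConnectedPart (BTemp X₁.Pi))ᵒᵖ, IsPerfect (tf₁.Φ.carrier A)}
    {NH₁ : Subgroup (Field.absoluteGaloisGroup K) → tf₁.category → ℕ+ → Prop} {A₁ : tf₁.category}
    {hA₁ : PreFrobenioid.IsFrobeniusTrivial tf₁.toElem A₁} {hA₁' : SemiGraphs.IsGaloisObj A₁.base.obj}
    {tf₂ : TemperedFrobenioid
      (RealifiedDivisorMonoids.ofRlfZWeak (DivisorMonoids.ofGaloisActionCoset GA₂ hC₂)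
        (DivisorMonoids.ofGaloisActionCoset_isPerfFactorialCof GA₂ hC₂))
      (ConnectedPart (BTemp X₂.Pi)) (treeCatVocab (ConnectedPart (BTemp X₂.Pi)) IsRational₂ IsStrictlyRational₂)}
    {hZ₂ : tf₂.monoidType = MonoidType.Z} {hP₂ : ∀ B : (ConnectedPart (BTemp X₂.Pi))ᵒᵖ, IsPerfect (tf₂.Φ.carrier B)}
    {NH₂ : Subgroup (Field.absoluteGaloisGroup K') → tf₂.category → ℕ+ → Prop} {A₂ : tf₂.category}
    {hA₂ : PreFrobenioid.IsFrobeniusTrivial tf₂.toElem A₂} {hA₂' : SemiGraphs.IsGaloisObj A₂.base.obj}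
    (h : Thm44Hyp (mkOfConnectedTemperoid X₁ tf₁ hZ₁ hP₁ NH₁ A₁ hA₁ hA₁')
      (mkOfConnectedTemperoid X₂ tf₂ hZ₂ hP₂ NH₂ A₂ hA₂ hA₂'))
    (hF₁ : PreFrobenioid.IsFrobenioid tf₁.toElem) (hF₂ : PreFrobenioid.IsFrobenioid tf₂.toElem)
    (h3 : h.PreservesFrobeniusStructure) (h15 : h.PreservesNHSaturatedBsFld) :
    Thm44_i (V := treeMonoidVocabWeak.{u}) h ∧ Thm44_ii h (h.psiModel hF₁ hF₂ h3) ∧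
      Thm44_iii h (h.psiModel hF₁ hF₂ h3) ∧
      h.PreservesNthRoots (h.psiModel hF₁ hF₂ h3) (fun φ f => tf₁.pullFracModel φ f)
        (fun φ f => tf₂.pullFracModel φ f) :=
  h.thm44_mkOfConnectedTemperoid_of_hBinj_treeVocabWeak hF₁ hF₂ h3
    (DivisorMonoids.ofGaloisActionCoset_ofRlfZWeak_hBinj GA₁ hC₁ _)
    (DivisorMonoids.ofGaloisActionCoset_ofRlfZWeak_hBinj GA₂ hC₂ _) h15

/-- **The same with every ψ-slot proof supplied by the tree** — literally ⇐ {T44-L15b}. [cite: MochizukiEtTh2009, Thm 4.4 p.94] -/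
theorem Thm44Hyp.thm44_mkOfConnectedTemperoid_ofGaloisActionCoset_treeVocabWeak'
    {tf₁ : TemperedFrobenioid
      (RealifiedDivisorMonoids.ofRlfZWeak (DivisorMonoids.ofGaloisActionCoset GA₁ hC₁)
        (DivisorMonoids.ofGaloisActionCoset_isPerfFactorialCof GA₁ hC₁))
      (ConnectedPart (BTemp X₁.Pi)) (treeCatVocab (ConnectedPart (BTemp X₁.Pi)) IsRational₁ IsStrictlyRational₁)}
    {hZ₁ : tf₁.monoidType = MonoidType.Z} {hP₁ : ∀ A : (ConnectedPart (BTemp X₁.Pi))ᵒᵖ, IsPerfect (tf₁.Φ.carrier A)}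
    {NH₁ : Subgroup (Field.absoluteGaloisGroup K) → tf₁.category → ℕ+ → Prop} {A₁ : tf₁.category}
    {hA₁ : PreFrobenioid.IsFrobeniusTrivial tf₁.toElem A₁} {hA₁' : SemiGraphs.IsGaloisObj A₁.base.obj}
    {tf₂ : TemperedFrobenioid
      (RealifiedDivisorMonoids.ofRlfZWeak (DivisorMonoids.ofGaloisActionCoset GA₂ hC₂)
        (DivisorMonoids.ofGaloisActionCoset_isPerfFactorialCof GA₂ hC₂))
      (ConnectedPart (BTemp X₂.Pi)) (treeCatVocab (ConnectedPart (BTemp X₂.Pi)) IsRational₂ IsStrictlyRational₂)}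
    {hZ₂ : tf₂.monoidType = MonoidType.Z} {hP₂ : ∀ B : (ConnectedPart (BTemp X₂.Pi))ᵒᵖ, IsPerfect (tf₂.Φ.carrier B)}
    {NH₂ : Subgroup (Field.absoluteGaloisGroup K') → tf₂.category → ℕ+ → Prop} {A₂ : tf₂.category}
    {hA₂ : PreFrobenioid.IsFrobeniusTrivial tf₂.toElem A₂} {hA₂' : SemiGraphs.IsGaloisObj A₂.base.obj}
    (h : Thm44Hyp (mkOfConnectedTemperoid X₁ tf₁ hZ₁ hP₁ NH₁ A₁ hA₁ hA₁')
      (mkOfConnectedTemperoid X₂ tf₂ hZ₂ hP₂ NH₂ A₂ hA₂ hA₂')) (h15 : h.PreservesNHSaturatedBsFld) :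
    Thm44_i (V := treeMonoidVocabWeak.{u}) h ∧
      Thm44_ii h (h.psiModel (isFrobenioid_ofGaloisActionCoset_treeVocabWeak GA₁ hC₁)
        (isFrobenioid_ofGaloisActionCoset_treeVocabWeak GA₂ hC₂)
        (h.preservesFrobeniusStructure_mkOfConnectedTemperoid_ofGaloisActionCoset_treeVocabWeak GA₁ hC₁ GA₂ hC₂)) ∧
      Thm44_iii h (h.psiModel (isFrobenioid_ofGaloisActionCoset_treeVocabWeak GA₁ hC₁)
        (isFrobenioid_ofGaloisActionCoset_treeVocabWeak GA₂ hC₂)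
        (h.preservesFrobeniusStructure_mkOfConnectedTemperoid_ofGaloisActionCoset_treeVocabWeak GA₁ hC₁ GA₂ hC₂)) ∧
      h.PreservesNthRoots (h.psiModel (isFrobenioid_ofGaloisActionCoset_treeVocabWeak GA₁ hC₁)
        (isFrobenioid_ofGaloisActionCoset_treeVocabWeak GA₂ hC₂)
        (h.preservesFrobeniusStructure_mkOfConnectedTemperoid_ofGaloisActionCoset_treeVocabWeak GA₁ hC₁ GA₂ hC₂))
        (fun φ f => tf₁.pullFracModel φ f) (fun φ f => tf₂.pullFracModel φ f) :=
  h.thm44_mkOfConnectedTemperoid_ofGaloisActionCoset_treeVocabWeak GA₁ hC₁ GA₂ hC₂ _ _ _ h15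

end Weak

section WeakRoots

variable {Z₁ : LogDivisorModel.{u}} {G₁ : Type u} [Group G₁] (GA₁ : Z₁.GaloisAction G₁) (hC₁ : Z₁.CuspLaws)
  {Z₂ : LogDivisorModel.{u}} {G₂ : Type u} [Group G₂] (GA₂ : Z₂.GaloisAction G₂) (hC₂ : Z₂.CuspLaws)
  {K : Type u} [Field K] {K' : Type u} [Field K'] {X₁ : SemiGraphs.TemperedArithmeticGroup.{u} K}
  {X₂ : SemiGraphs.TemperedArithmeticGroup.{u} K'}
  {IsRational₁ IsStrictlyRational₁ : ((ConnectedPart (BTemp X₁.Pi))ᵒᵖ ⥤ CommMonCat.{u}) → Prop}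
  {IsRational₂ IsStrictlyRational₂ : ((ConnectedPart (BTemp X₂.Pi))ᵒᵖ ⥤ CommMonCat.{u}) → Prop}

/-- **[EtTh] Thm 4.4 (i) ∧ (ii) ∧ (iii) ∧ (`N`-th roots) at the genuine connected base over the WEAK coset data AT THE
ROOTS READING of the `(N, H_⊙^{bs-fld})`-slot ⇐ NOTHING** (`ψ = psiModel hF₁ hF₂ h3`, any proofs; `K : Type u`).
[cite: MochizukiEtTh2009, Thm 4.4 p.94] -/
theorem Thm44Hyp.thm44_mkOfConnectedTemperoid_rootsReading_ofGaloisActionCoset_treeVocabWeak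
    {tf₁ : TemperedFrobenioid
      (RealifiedDivisorMonoids.ofRlfZWeak (DivisorMonoids.ofGaloisActionCoset GA₁ hC₁)
        (DivisorMonoids.ofGaloisActionCoset_isPerfFactorialCof GA₁ hC₁))
      (ConnectedPart (BTemp X₁.Pi)) (treeCatVocab (ConnectedPart (BTemp X₁.Pi)) IsRational₁ IsStrictlyRational₁)}
    {hZ₁ : tf₁.monoidType = MonoidType.Z} {hP₁ : ∀ A : (ConnectedPart (BTemp X₁.Pi))ᵒᵖ, IsPerfect (tf₁.Φ.carrier A)}
    {A₁ : tf₁.category} {hA₁ : PreFrobenioid.IsFrobeniusTrivial tf₁.toElem A₁}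
    {hA₁' : SemiGraphs.IsGaloisObj A₁.base.obj}
    {tf₂ : TemperedFrobenioid
      (RealifiedDivisorMonoids.ofRlfZWeak (DivisorMonoids.ofGaloisActionCoset GA₂ hC₂)
        (DivisorMonoids.ofGaloisActionCoset_isPerfFactorialCof GA₂ hC₂))
      (ConnectedPart (BTemp X₂.Pi)) (treeCatVocab (ConnectedPart (BTemp X₂.Pi)) IsRational₂ IsStrictlyRational₂)}
    {hZ₂ : tf₂.monoidType = MonoidType.Z} {hP₂ : ∀ B : (ConnectedPart (BTemp X₂.Pi))ᵒᵖ, IsPerfect (tf₂.Φ.carrier B)}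
    {A₂ : tf₂.category} {hA₂ : PreFrobenioid.IsFrobeniusTrivial tf₂.toElem A₂}
    {hA₂' : SemiGraphs.IsGaloisObj A₂.base.obj}
    (h : Thm44Hyp
      (mkOfConnectedTemperoid X₁ tf₁ hZ₁ hP₁
        (fun _ A M => ∀ (g : A.base ⟶ A₁.base) (x : tf₁.ratFnFunctor.obj (op A₁.base)),
          divB tf₁.divisorMonoid tf₁.ratFnFunctor tf₁.divBNatTrans (op A₁.base) x = 1 →
            ∃ ζ : tf₁.ratFnFunctor.obj (op A.base), ζ ^ (M : ℕ) = pull tf₁.ratFnFunctor g x)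
        A₁ hA₁ hA₁')
      (mkOfConnectedTemperoid X₂ tf₂ hZ₂ hP₂
        (fun _ A M => ∀ (g : A.base ⟶ A₂.base) (x : tf₂.ratFnFunctor.obj (op A₂.base)),
          divB tf₂.divisorMonoid tf₂.ratFnFunctor tf₂.divBNatTrans (op A₂.base) x = 1 →
            ∃ ζ : tf₂.ratFnFunctor.obj (op A.base), ζ ^ (M : ℕ) = pull tf₂.ratFnFunctor g x)
        A₂ hA₂ hA₂'))
    (hF₁ : PreFrobenioid.IsFrobenioid tf₁.toElem) (hF₂ : PreFrobenioid.IsFrobenioid tf₂.toElem)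
    (h3 : h.PreservesFrobeniusStructure) :
    Thm44_i (V := treeMonoidVocabWeak.{u}) h ∧ Thm44_ii h (h.psiModel hF₁ hF₂ h3) ∧
      Thm44_iii h (h.psiModel hF₁ hF₂ h3) ∧
      h.PreservesNthRoots (h.psiModel hF₁ hF₂ h3) (fun φ f => tf₁.pullFracModel φ f)
        (fun φ f => tf₂.pullFracModel φ f) :=
  h.thm44_mkOfConnectedTemperoid_of_hBinj_treeVocabWeak hF₁ hF₂ h3
    (DivisorMonoids.ofGaloisActionCoset_ofRlfZWeak_hBinj GA₁ hC₁ _)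
    (DivisorMonoids.ofGaloisActionCoset_ofRlfZWeak_hBinj GA₂ hC₂ _)
    (Thm44Hyp.preservesNHSaturatedBsFld_rootsReading tf₁ hZ₁ hP₁ _ _ _ A₁ hA₁ hA₁' tf₂ hZ₂ hP₂ _ _ _ A₂ hA₂ hA₂' h
      hF₁ hF₂ h3)

end WeakRoots

/-! ### §2 Strong `Λ = ℤ` coset data (`ofRlfZ … hpf`) -/

section Strong

variable {Z₁ : LogDivisorModel.{u}} {G₁ : Type u} [Group G₁] (GA₁ : Z₁.GaloisAction G₁) (hC₁ : Z₁.CuspLaws)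
  (hpf₁ : ∀ Y : (InducedCategory (Action (Type u) G₁) (cosetGSet G₁))ᵒᵖ,
    IsPerfFactorial ((DivisorMonoids.ofGaloisActionCoset GA₁ hC₁).Φ₀.obj Y))
  {Z₂ : LogDivisorModel.{u}} {G₂ : Type u} [Group G₂] (GA₂ : Z₂.GaloisAction G₂) (hC₂ : Z₂.CuspLaws)
  (hpf₂ : ∀ Y : (InducedCategory (Action (Type u) G₂) (cosetGSet G₂))ᵒᵖ,
    IsPerfFactorial ((DivisorMonoids.ofGaloisActionCoset GA₂ hC₂).Φ₀.obj Y))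
  {K : Type u} [Field K] {K' : Type u} [Field K'] {X₁ : SemiGraphs.TemperedArithmeticGroup.{u} K}
  {X₂ : SemiGraphs.TemperedArithmeticGroup.{u} K'}
  {IsRational₁ IsStrictlyRational₁ : ((ConnectedPart (BTemp X₁.Pi))ᵒᵖ ⥤ CommMonCat.{u}) → Prop}
  {IsRational₂ IsStrictlyRational₂ : ((ConnectedPart (BTemp X₂.Pi))ᵒᵖ ⥤ CommMonCat.{u}) → Prop}

/-- **«`C` is a Frobenioid» over the strong coset data** — no input beyond `hpf₁`. [cite: MochizukiEtTh2009, Def 3.6 p.77] -/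
theorem isFrobenioid_ofGaloisActionCoset
    {tf₁ : TemperedFrobenioid (RealifiedDivisorMonoids.ofRlfZ (DivisorMonoids.ofGaloisActionCoset GA₁ hC₁) hpf₁)
      (ConnectedPart (BTemp X₁.Pi)) (treeCatVocab (ConnectedPart (BTemp X₁.Pi)) IsRational₁ IsStrictlyRational₁)}
    : PreFrobenioid.IsFrobenioid tf₁.toElem :=
  tf₁.isFrobenioid_of_structural (DivisorMonoids.ofGaloisActionCoset_ofRlfZ_hBinj GA₁ hC₁ hpf₁) fun α hα =>
    (QuasiTemperoid.BTempConnected.connectedPart_isOfFSMType (G := X₁.Pi)).isIso_of_isFSM α hα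

/-- **T44-L03 over the strong coset data.** [cite: MochizukiEtTh2009, Thm 4.4 p.95] -/
theorem Thm44Hyp.preservesFrobeniusStructure_mkOfConnectedTemperoid_ofGaloisActionCoset
    {tf₁ : TemperedFrobenioid (RealifiedDivisorMonoids.ofRlfZ (DivisorMonoids.ofGaloisActionCoset GA₁ hC₁) hpf₁)
      (ConnectedPart (BTemp X₁.Pi)) (treeCatVocab (ConnectedPart (BTemp X₁.Pi)) IsRational₁ IsStrictlyRational₁)}
    {hZ₁ : tf₁.monoidType = MonoidType.Z} {hP₁ : ∀ A : (ConnectedPart (BTemp X₁.Pi))ᵒᵖ, IsPerfect (tf₁.Φ.carrier A)}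
    {NH₁ : Subgroup (Field.absoluteGaloisGroup K) → tf₁.category → ℕ+ → Prop} {A₁ : tf₁.category}
    {hA₁ : PreFrobenioid.IsFrobeniusTrivial tf₁.toElem A₁} {hA₁' : SemiGraphs.IsGaloisObj A₁.base.obj}
    {tf₂ : TemperedFrobenioid (RealifiedDivisorMonoids.ofRlfZ (DivisorMonoids.ofGaloisActionCoset GA₂ hC₂) hpf₂)
      (ConnectedPart (BTemp X₂.Pi)) (treeCatVocab (ConnectedPart (BTemp X₂.Pi)) IsRational₂ IsStrictlyRational₂)}
    {hZ₂ : tf₂.monoidType = MonoidType.Z} {hP₂ : ∀ B : (ConnectedPart (BTemp X₂.Pi))ᵒᵖ, IsPerfect (tf₂.Φ.carrier B)}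
    {NH₂ : Subgroup (Field.absoluteGaloisGroup K') → tf₂.category → ℕ+ → Prop} {A₂ : tf₂.category}
    {hA₂ : PreFrobenioid.IsFrobeniusTrivial tf₂.toElem A₂} {hA₂' : SemiGraphs.IsGaloisObj A₂.base.obj}
    (h : Thm44Hyp (mkOfConnectedTemperoid X₁ tf₁ hZ₁ hP₁ NH₁ A₁ hA₁ hA₁')
      (mkOfConnectedTemperoid X₂ tf₂ hZ₂ hP₂ NH₂ A₂ hA₂ hA₂')) :
    h.PreservesFrobeniusStructure :=
  h.preservesFrobeniusStructure_mkOfConnectedTemperoid_of_hBinj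
    (DivisorMonoids.ofGaloisActionCoset_ofRlfZ_hBinj GA₁ hC₁ hpf₁)
    (DivisorMonoids.ofGaloisActionCoset_ofRlfZ_hBinj GA₂ hC₂ hpf₂)

/-- **[EtTh] Theorem 4.4 (i) ∧ (ii) ∧ (iii) ∧ (`N`-th roots) at the genuine connected base over the STRONG `Λ = ℤ`
coset data ⇐ {T44-L15b} ONLY** (beyond `hpf₁` / `hpf₂`). [cite: MochizukiEtTh2009, Thm 4.4 p.94] -/
theorem Thm44Hyp.thm44_mkOfConnectedTemperoid_ofGaloisActionCoset
    {tf₁ : TemperedFrobenioid (RealifiedDivisorMonoids.ofRlfZ (DivisorMonoids.ofGaloisActionCoset GA₁ hC₁) hpf₁)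
      (ConnectedPart (BTemp X₁.Pi)) (treeCatVocab (ConnectedPart (BTemp X₁.Pi)) IsRational₁ IsStrictlyRational₁)}
    {hZ₁ : tf₁.monoidType = MonoidType.Z} {hP₁ : ∀ A : (ConnectedPart (BTemp X₁.Pi))ᵒᵖ, IsPerfect (tf₁.Φ.carrier A)}
    {NH₁ : Subgroup (Field.absoluteGaloisGroup K) → tf₁.category → ℕ+ → Prop} {A₁ : tf₁.category}
    {hA₁ : PreFrobenioid.IsFrobeniusTrivial tf₁.toElem A₁} {hA₁' : SemiGraphs.IsGaloisObj A₁.base.obj}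
    {tf₂ : TemperedFrobenioid (RealifiedDivisorMonoids.ofRlfZ (DivisorMonoids.ofGaloisActionCoset GA₂ hC₂) hpf₂)
      (ConnectedPart (BTemp X₂.Pi)) (treeCatVocab (ConnectedPart (BTemp X₂.Pi)) IsRational₂ IsStrictlyRational₂)}
    {hZ₂ : tf₂.monoidType = MonoidType.Z} {hP₂ : ∀ B : (ConnectedPart (BTemp X₂.Pi))ᵒᵖ, IsPerfect (tf₂.Φ.carrier B)}
    {NH₂ : Subgroup (Field.absoluteGaloisGroup K') → tf₂.category → ℕ+ → Prop} {A₂ : tf₂.category}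
    {hA₂ : PreFrobenioid.IsFrobeniusTrivial tf₂.toElem A₂} {hA₂' : SemiGraphs.IsGaloisObj A₂.base.obj}
    (h : Thm44Hyp (mkOfConnectedTemperoid X₁ tf₁ hZ₁ hP₁ NH₁ A₁ hA₁ hA₁')
      (mkOfConnectedTemperoid X₂ tf₂ hZ₂ hP₂ NH₂ A₂ hA₂ hA₂'))
    (hF₁ : PreFrobenioid.IsFrobenioid tf₁.toElem) (hF₂ : PreFrobenioid.IsFrobenioid tf₂.toElem)
    (h3 : h.PreservesFrobeniusStructure) (h15 : h.PreservesNHSaturatedBsFld) :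
    Thm44_i h ∧ Thm44_ii h (h.psiModel hF₁ hF₂ h3) ∧ Thm44_iii h (h.psiModel hF₁ hF₂ h3) ∧
      h.PreservesNthRoots (h.psiModel hF₁ hF₂ h3) (fun φ f => tf₁.pullFracModel φ f)
        (fun φ f => tf₂.pullFracModel φ f) :=
  h.thm44_mkOfConnectedTemperoid_of_hBinj hF₁ hF₂ h3 (DivisorMonoids.ofGaloisActionCoset_ofRlfZ_hBinj GA₁ hC₁ hpf₁)
    (DivisorMonoids.ofGaloisActionCoset_ofRlfZ_hBinj GA₂ hC₂ hpf₂) h15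

/-- **At the roots reading over the strong coset data ⇐ NOTHING** beyond `hpf₁` / `hpf₂`.
[cite: MochizukiEtTh2009, Thm 4.4 p.94] -/
theorem Thm44Hyp.thm44_mkOfConnectedTemperoid_rootsReading_ofGaloisActionCoset
    {tf₁ : TemperedFrobenioid (RealifiedDivisorMonoids.ofRlfZ (DivisorMonoids.ofGaloisActionCoset GA₁ hC₁) hpf₁)
      (ConnectedPart (BTemp X₁.Pi)) (treeCatVocab (ConnectedPart (BTemp X₁.Pi)) IsRational₁ IsStrictlyRational₁)}
    {hZ₁ : tf₁.monoidType = MonoidType.Z} {hP₁ : ∀ A : (ConnectedPart (BTemp X₁.Pi))ᵒᵖ, IsPerfect (tf₁.Φ.carrier A)}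
    {A₁ : tf₁.category} {hA₁ : PreFrobenioid.IsFrobeniusTrivial tf₁.toElem A₁}
    {hA₁' : SemiGraphs.IsGaloisObj A₁.base.obj}
    {tf₂ : TemperedFrobenioid (RealifiedDivisorMonoids.ofRlfZ (DivisorMonoids.ofGaloisActionCoset GA₂ hC₂) hpf₂)
      (ConnectedPart (BTemp X₂.Pi)) (treeCatVocab (ConnectedPart (BTemp X₂.Pi)) IsRational₂ IsStrictlyRational₂)}
    {hZ₂ : tf₂.monoidType = MonoidType.Z} {hP₂ : ∀ B : (ConnectedPart (BTemp X₂.Pi))ᵒᵖ, IsPerfect (tf₂.Φ.carrier B)}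
    {A₂ : tf₂.category} {hA₂ : PreFrobenioid.IsFrobeniusTrivial tf₂.toElem A₂}
    {hA₂' : SemiGraphs.IsGaloisObj A₂.base.obj}
    (h : Thm44Hyp
      (mkOfConnectedTemperoid X₁ tf₁ hZ₁ hP₁
        (fun _ A M => ∀ (g : A.base ⟶ A₁.base) (x : tf₁.ratFnFunctor.obj (op A₁.base)),
          divB tf₁.divisorMonoid tf₁.ratFnFunctor tf₁.divBNatTrans (op A₁.base) x = 1 →
            ∃ ζ : tf₁.ratFnFunctor.obj (op A.base), ζ ^ (M : ℕ) = pull tf₁.ratFnFunctor g x)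
        A₁ hA₁ hA₁')
      (mkOfConnectedTemperoid X₂ tf₂ hZ₂ hP₂
        (fun _ A M => ∀ (g : A.base ⟶ A₂.base) (x : tf₂.ratFnFunctor.obj (op A₂.base)),
          divB tf₂.divisorMonoid tf₂.ratFnFunctor tf₂.divBNatTrans (op A₂.base) x = 1 →
            ∃ ζ : tf₂.ratFnFunctor.obj (op A.base), ζ ^ (M : ℕ) = pull tf₂.ratFnFunctor g x)
        A₂ hA₂ hA₂'))
    (hF₁ : PreFrobenioid.IsFrobenioid tf₁.toElem) (hF₂ : PreFrobenioid.IsFrobenioid tf₂.toElem)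
    (h3 : h.PreservesFrobeniusStructure) :
    Thm44_i h ∧ Thm44_ii h (h.psiModel hF₁ hF₂ h3) ∧ Thm44_iii h (h.psiModel hF₁ hF₂ h3) ∧
      h.PreservesNthRoots (h.psiModel hF₁ hF₂ h3) (fun φ f => tf₁.pullFracModel φ f)
        (fun φ f => tf₂.pullFracModel φ f) :=
  Thm44Hyp.thm44_mkOfConnectedTemperoid_rootsReading_of_hBinj tf₁ hZ₁ hP₁ A₁ hA₁ hA₁' tf₂ hZ₂ hP₂ A₂ hA₂ hA₂' h hF₁ hF₂
    h3 (DivisorMonoids.ofGaloisActionCoset_ofRlfZ_hBinj GA₁ hC₁ hpf₁)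
    (DivisorMonoids.ofGaloisActionCoset_ofRlfZ_hBinj GA₂ hC₂ hpf₂)

end Strong

end BiKummerSetting

end Literature.AnabelianGeometry.EtaleTheta

end
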